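import Mathlib.Data.Real.Basic
import Mathlib.Data.List.Sublists
import Mathlib.Data.Fintype.Prod
import Mathlib.Data.Fintype.List
import Mathlib.Algebra.BigOperators.Group.List.Basic
import Mathlib.Algebra.BigOperators.Ring.List
import Mathlib.Tactic.Ring
import Mathlib.Tactic.FinCases
import HarnessLib

/-!
# Port dictionary, part 1: the abstract compass gadget and its route enumerations

Support file for item stmt-CriticalPhenomena-6966 (`SAWCompassLattice.PortDictionary`), stub
`stub_portDictionary` of line `Sketch` of crux stmt-CriticalPhenomena-14221 (`HexTransfer`).

The COMPASS GADGET of one face is the graph on `Fin 3 × Fin 4` (layer `0` = terminals `Q_i`,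
layer `1` = `A_i`, layer `2` = inner `I_i`) with edges `Q_i A_i`, `Q_i A_{i-1}` (outer 8-cycle,
fugacity `α`), spokes `A_i I_i` (fugacity `s`) and the inner 4-cycle `I_i I_{i+1}` (fugacity `β`) —
the `inr/inr` case of the relation `R` of the item, without the face coordinate.  Everything here
is finite and kernel-checked (`decide`):
* `pathsFrom` / `routes k k'`: first-step enumeration of the vertex lists of all simple paths of the
  gadget between terminals `(0,k)` and `(0,k')`, with its specification `mem_routes_iff`;
* `routeW α β s r`: the product of the edge fugacities along a route, `= α^a s^b β^c` for the
  exponent triple `ecount r` (`routeW_eq_mono`);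
* the enumeration identities: the routes between adjacent terminals have generating polynomial
  `Tadj` (22 routes), between opposite terminals `Topp` (24 routes); the vertex-disjoint ordered
  pairs of routes joining two complementary adjacent terminal pairs have polynomial `Dpair`
  (15 pairs); there is none for the crossing pairing `{Q₀Q₂, Q₁Q₃}` (planarity of the gadget) and
  none when the two terminal pairs share a terminal.
`Tadj`, `Topp`, `Dpair` are literally the three integer polynomials of the item.
-/

namespace Summit.CriticalPhenomena.SAWScalingLimit.Cruxes.HexTransfer.Sketch.PortDict

/-! ## The gadget graph -/

/-- A vertex of the abstract compass gadget: (layer, position), layer `0` = terminal `Q_i`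
(joined to the port on side `i`), `1` = `A_i` (outer cycle), `2` = `I_i` (inner cycle). -/
abbrev Node : Type := Fin 3 × Fin 4

/-- The one-directional internal relation of the item's `R` (inr/inr case, same face):
`Q_i → A_i, A_{i-1}`, `A_i → I_i`, `I_i → I_{i+1}`, as a Boolean. -/
def r0B (q q' : Node) : Bool :=
  (q.1 = 0 ∧ q'.1 = 1 ∧ (q'.2 = q.2 ∨ q'.2 + 1 = q.2)) ∨ (q.1 = 1 ∧ q'.1 = 2 ∧ q'.2 = q.2) ∨
    (q.1 = 2 ∧ q'.1 = 2 ∧ q'.2 = q.2 + 1)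

/-- Adjacency of the gadget (symmetrised `r0B`), as a Boolean. -/
def adjB (q q' : Node) : Bool := r0B q q' || r0B q' q

/-- `adjB` is symmetric. -/
theorem adjB_comm (q q' : Node) : adjB q q' = adjB q' q := by
  unfold adjB; rw [Bool.or_comm]

/-- An integer code of a vertex (used only to make the kernel computations fast). -/
def code (q : Node) : ℕ := 4 * q.1.val + q.2.val

/-- `code` is injective. -/
theorem code_inj {q q' : Node} : code q = code q' ↔ q = q' := by
  revert q q'; decide

/-- Membership through codes. -/
theorem code_mem_map_iff {q : Node} {l : List Node} : code q ∈ l.map code ↔ q ∈ l := by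
  rw [List.mem_map]
  constructor
  · rintro ⟨x, hx, h⟩
    rwa [← code_inj.1 h]
  · exact fun h => ⟨q, h, rfl⟩

/-- The twelve vertices of the gadget. -/
def allNodes : List Node :=
  [(0, 0), (0, 1), (0, 2), (0, 3), (1, 0), (1, 1), (1, 2), (1, 3), (2, 0), (2, 1), (2, 2), (2, 3)]

/-- Every vertex is listed. -/
theorem mem_allNodes (q : Node) : q ∈ allNodes := by
  revert q; decide

/-- The neighbours of a vertex. -/
def nbrs (q : Node) : List Node := allNodes.filter fun q' => adjB q q'

/-- `nbrs` lists exactly the neighbours. -/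
theorem mem_nbrs {q q' : Node} : q' ∈ nbrs q ↔ adjB q q' = true := by
  simp [nbrs, mem_allNodes]

/-! ## Enumeration of simple paths -/

/-- First-step enumeration of the vertex lists of the simple paths of the gadget with at most
`n + 1` vertices, starting at `u`, whose vertices after the first have codes outside `vis`. -/
def pathsFrom : ℕ → Node → List ℕ → List (List Node)
  | 0, u, _ => [[u]]
  | n + 1, u, vis =>
      [u] :: ((nbrs u).filter fun w => !(vis.elem (code w)) && !(code w == code u)).flatMap
        fun w => (pathsFrom n w (code u :: vis)).map (List.cons u)

/-- **Specification of `pathsFrom`.** -/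
theorem mem_pathsFrom_iff : ∀ (n : ℕ) (u : Node) (vis : List ℕ) (l : List Node),
    l ∈ pathsFrom n u vis ↔ l.head? = some u ∧ l.IsChain (fun q q' => adjB q q' = true) ∧ l.Nodup ∧
      l.length ≤ n + 1 ∧ ∀ x ∈ l.tail, code x ∉ vis := by
  intro n
  induction n with
  | zero =>
    intro u vis l
    simp only [pathsFrom, List.mem_singleton, zero_add]
    constructor
    · rintro rfl
      simp
    · rintro ⟨h1, -, -, h4, -⟩
      match l, h1, h4 with
      | [v], h1, _ => simpa using h1
  | succ n ih =>
    intro u vis l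
    simp only [pathsFrom, List.mem_cons, List.mem_flatMap, List.mem_filter, List.mem_map, mem_nbrs,
      Bool.and_eq_true, Bool.not_eq_true', List.elem_eq_mem, decide_eq_false_iff_not,
      beq_eq_false_iff_ne, ne_eq, code_inj]
    constructor
    · rintro (rfl | ⟨w, ⟨hadj, hwvis, hwu⟩, l', hl', rfl⟩)
      · simp
      · obtain ⟨h1, h2, h3, h4, h5⟩ := (ih w (code u :: vis) l').1 hl'
        obtain ⟨t, rfl⟩ : ∃ t, l' = w :: t := by
          cases l' with
          | nil => simp at h1
          | cons v t => simp only [List.head?_cons, Option.some.injEq] at h1; exact ⟨t, by rw [h1]⟩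
        simp only [List.tail_cons, List.mem_cons, not_or, code_inj] at h5
        refine ⟨rfl, List.IsChain.cons_cons hadj h2, List.nodup_cons.2 ⟨?_, h3⟩,
          by simp only [List.length_cons] at h4 ⊢; omega, ?_⟩
        · simp only [List.mem_cons, not_or]
          exact ⟨fun h => hwu h.symm, fun h => (h5 u h).1 rfl⟩
        · intro x hx
          simp only [List.tail_cons, List.mem_cons] at hx
          rcases hx with rfl | hx
          · exact hwvis
          · exact (h5 x hx).2
    · rintro ⟨h1, h2, h3, h4, h5⟩
      match l, h1 with
      | [v], h1 =>
        simp only [List.head?_cons, Option.some.injEq] at h1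
        exact Or.inl (by rw [h1])
      | v :: w :: t, h1 =>
        simp only [List.head?_cons, Option.some.injEq] at h1
        subst h1
        right
        simp only [List.tail_cons, List.mem_cons, forall_eq_or_imp] at h5
        have hvw : v ≠ w := fun h => (List.nodup_cons.1 h3).1 (by simp [h])
        have hvt : v ∉ t := fun h => (List.nodup_cons.1 h3).1 (by simp [h])
        rw [List.isChain_cons_cons] at h2
        refine ⟨w, ⟨h2.1, h5.1, fun h => hvw h.symm⟩, w :: t, ?_, rfl⟩
        refine (ih w (code v :: vis) (w :: t)).2 ⟨rfl, h2.2, (List.nodup_cons.1 h3).2,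
          by simp only [List.length_cons] at h4 ⊢; omega, ?_⟩
        intro x hx
        simp only [List.tail_cons] at hx
        simp only [List.mem_cons, not_or, code_inj]
        exact ⟨fun h => hvt (h ▸ hx), h5.2 x hx⟩

/-- **The routes** between terminals `Q_k` and `Q_{k'}`: the vertex lists of all simple paths of
the gadget from `(0, k)` to `(0, k')` (paths through the other terminals included). -/
def routes (k k' : Fin 4) : List (List Node) :=
  (pathsFrom 11 (0, k) []).filter fun l => l.getLast? = some (0, k')

/-- **Specification of `routes`.** -/
theorem mem_routes_iff {k k' : Fin 4} {r : List Node} :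
    r ∈ routes k k' ↔ r.head? = some (0, k) ∧ r.getLast? = some (0, k') ∧
      r.IsChain (fun q q' => adjB q q' = true) ∧ r.Nodup := by
  rw [routes, List.mem_filter, mem_pathsFrom_iff, decide_eq_true_eq]
  constructor
  · rintro ⟨⟨h1, h2, h3, -, -⟩, h5⟩
    exact ⟨h1, h5, h2, h3⟩
  · rintro ⟨h1, h2, h3, h4⟩
    refine ⟨⟨h1, h3, h4, ?_, fun x _ => List.not_mem_nil⟩, h2⟩
    have := h4.length_le_card
    simp only [Fintype.card_prod, Fintype.card_fin] at this
    omega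

/-- The terminals of a route belong to it. -/
theorem ends_mem_of_mem_routes {k k' : Fin 4} {r : List Node} (h : r ∈ routes k k') :
    ((0 : Fin 3), k) ∈ r ∧ ((0 : Fin 3), k') ∈ r :=
  ⟨List.mem_of_mem_head? (mem_routes_iff.1 h).1, List.mem_of_getLast? (mem_routes_iff.1 h).2.1⟩

/-- The enumerated routes are pairwise distinct. -/
theorem nodup_routes : ∀ k k' : Fin 4, (routes k k').Nodup := by
  decide +kernel

/-- Avoidance test: no vertex of `r` lies in `U` (through codes, for fast kernel evaluation). -/
def avoidB (U r : List Node) : Bool :=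
  let cU := U.map code
  r.all fun x => !(cU.elem (code x))

/-- `avoidB U r` says that `r` avoids `U`. -/
theorem avoidB_iff {U r : List Node} : avoidB U r = true ↔ ∀ x ∈ r, x ∉ U := by
  simp [avoidB, code_mem_map_iff]

/-! ## Weights -/

/-- The fugacity of the gadget edge `q q'`: `α` on the outer cycle (one end a terminal), `s` on a
spoke, `β` on the inner cycle (the `inr/inr` case of the item's `y`). -/
def edgeW (α β s : ℝ) (q q' : Node) : ℝ :=
  if q.1 = 0 ∨ q'.1 = 0 then α else if q.1 = 1 ∨ q'.1 = 1 then s else β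

/-- The weight of a route: the product of the fugacities of its edges. -/
def routeW (α β s : ℝ) : List Node → ℝ
  | [] => 1
  | [_] => 1
  | q :: q' :: t => edgeW α β s q q' * routeW α β s (q' :: t)

/-- The exponent triple (number of `α`-, `s`-, `β`-edges) of a route. -/
def ecount : List Node → ℕ × ℕ × ℕ
  | [] => (0, 0, 0)
  | [_] => (0, 0, 0)
  | q :: q' :: t =>
    if q.1 = 0 ∨ q'.1 = 0 then ((ecount (q' :: t)).1 + 1, (ecount (q' :: t)).2.1, (ecount (q' :: t)).2.2)
    else if q.1 = 1 ∨ q'.1 = 1 then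
      ((ecount (q' :: t)).1, (ecount (q' :: t)).2.1 + 1, (ecount (q' :: t)).2.2)
    else ((ecount (q' :: t)).1, (ecount (q' :: t)).2.1, (ecount (q' :: t)).2.2 + 1)

/-- The monomial `α^a s^b β^c` of an exponent triple. -/
def mono (α β s : ℝ) (e : ℕ × ℕ × ℕ) : ℝ := α ^ e.1 * s ^ e.2.1 * β ^ e.2.2

/-- `mono` is multiplicative. -/
theorem mono_add (α β s : ℝ) (e e' : ℕ × ℕ × ℕ) : mono α β s (e + e') = mono α β s e * mono α β s e' := by
  simp only [mono, Prod.fst_add, Prod.snd_add, pow_add]; ring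

/-- The weight of a route is the monomial of its exponent triple. -/
theorem routeW_eq_mono (α β s : ℝ) : ∀ r : List Node, routeW α β s r = mono α β s (ecount r)
  | [] => by simp [routeW, ecount, mono]
  | [q] => by simp [routeW, ecount, mono]
  | q :: q' :: t => by
    rw [routeW, ecount, routeW_eq_mono α β s (q' :: t), edgeW]
    split_ifs <;> simp only [mono, pow_succ] <;> ring

/-- `T_adj`: the generating polynomial of the routes between adjacent terminals (the first
polynomial of the item). -/
def Tadj (α β s : ℝ) : ℝ :=
  α ^ 2 + α ^ 6 + s ^ 2 * (2 * α ^ 2 * β + 2 * α ^ 2 * β ^ 2 + 2 * α ^ 2 * β ^ 3 + 2 * α ^ 4 * β +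
    4 * α ^ 4 * β ^ 2 + 2 * α ^ 4 * β ^ 3 + 2 * α ^ 6 * β + 2 * α ^ 6 * β ^ 3) + 2 * s ^ 4 * α ^ 4 * β ^ 2

/-- `T_opp`: the generating polynomial of the routes between opposite terminals (the second
polynomial of the item). -/
def Topp (α β s : ℝ) : ℝ :=
  2 * α ^ 4 + s ^ 2 * (2 * α ^ 2 * β + 4 * α ^ 2 * β ^ 2 + 2 * α ^ 2 * β ^ 3 + 4 * α ^ 4 * β +
    4 * α ^ 4 * β ^ 3 + 4 * α ^ 6 * β ^ 2) + 2 * s ^ 4 * α ^ 4 * β ^ 2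

/-- `D`: the generating polynomial of the vertex-disjoint pairs of routes joining two complementary
adjacent terminal pairs (the third polynomial of the item). -/
def Dpair (α β s : ℝ) : ℝ :=
  α ^ 4 + s ^ 2 * (4 * α ^ 4 * β + 4 * α ^ 4 * β ^ 2 + 4 * α ^ 4 * β ^ 3) + 2 * s ^ 4 * α ^ 4 * β ^ 2

/-! ## The enumerations (kernel-checked) -/

/-- The exponent triples of the 22 routes between two adjacent terminals. -/
def Ladj : List (ℕ × ℕ × ℕ) :=
  [(2, 0, 0), (6, 0, 0), (2, 2, 1), (2, 2, 1), (2, 2, 2), (2, 2, 2), (2, 2, 3), (2, 2, 3), (4, 2, 1),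
    (4, 2, 1), (4, 2, 2), (4, 2, 2), (4, 2, 2), (4, 2, 2), (4, 2, 3), (4, 2, 3), (4, 4, 2), (4, 4, 2),
    (6, 2, 1), (6, 2, 1), (6, 2, 3), (6, 2, 3)]

/-- The exponent triples of the 24 routes between two opposite terminals. -/
def Lopp : List (ℕ × ℕ × ℕ) :=
  [(2, 2, 1), (2, 2, 1), (2, 2, 2), (2, 2, 2), (2, 2, 2), (2, 2, 2), (2, 2, 3), (2, 2, 3), (4, 0, 0),
    (4, 0, 0), (4, 2, 1), (4, 2, 1), (4, 2, 1), (4, 2, 1), (4, 2, 3), (4, 2, 3), (4, 2, 3), (4, 2, 3),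
    (4, 4, 2), (4, 4, 2), (6, 2, 2), (6, 2, 2), (6, 2, 2), (6, 2, 2)]

/-- The summed exponent triples of the 15 disjoint pairs of routes of a non-crossing pairing. -/
def LD : List (ℕ × ℕ × ℕ) :=
  [(4, 0, 0), (4, 2, 1), (4, 2, 1), (4, 2, 1), (4, 2, 1), (4, 2, 2), (4, 2, 2), (4, 2, 2), (4, 2, 2),
    (4, 2, 3), (4, 2, 3), (4, 2, 3), (4, 2, 3), (4, 4, 2), (4, 4, 2)]

/-- The ordered pairs (route `k₁ → k₁'`, route `k₂ → k₂'` avoiding it). -/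
def dpairs (k₁ k₁' k₂ k₂' : Fin 4) : List (List Node × List Node) :=
  (routes k₁ k₁').flatMap fun r₁ => ((routes k₂ k₂').filter (avoidB r₁)).map fun r₂ => (r₁, r₂)

/-- Enumeration: adjacent terminals (`k' = k ± 1`), 22 routes with exponents `Ladj`. -/
theorem perm_Ladj : ∀ k k' : Fin 4, (k' = k + 1 ∨ k = k' + 1) → ((routes k k').map ecount).Perm Ladj := by
  decide +kernel

/-- Enumeration: opposite terminals (`k' = k + 2`), 24 routes with exponents `Lopp`. -/
theorem perm_Lopp : ∀ k k' : Fin 4, k' = k + 2 → ((routes k k').map ecount).Perm Lopp := by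
  decide +kernel

/-- Enumeration: for the two non-crossing pairings of the four terminals into two adjacent pairs
(all orientations and orders), 15 disjoint ordered pairs of routes with summed exponents `LD`. -/
theorem perm_LD : ∀ k₁ k₁' k₂ k₂' : Fin 4,
    ((k₁' = k₁ + 1 ∧ (k₂ = k₁ + 2 ∧ k₂' = k₁ + 3 ∨ k₂ = k₁ + 3 ∧ k₂' = k₁ + 2)) ∨
      (k₁ = k₁' + 1 ∧ (k₂ = k₁' + 2 ∧ k₂' = k₁' + 3 ∨ k₂ = k₁' + 3 ∧ k₂' = k₁' + 2))) →
    ((dpairs k₁ k₁' k₂ k₂').map fun p => ecount p.1 + ecount p.2).Perm LD := by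
  decide +kernel

/-- Enumeration (planarity of the gadget): a route joining two opposite terminals meets every
route joining the two other terminals. -/
theorem not_avoid_of_cross : ∀ k₁ k₁' k₂ k₂' : Fin 4,
    (k₁' = k₁ + 2 ∧ (k₂ = k₁ + 1 ∧ k₂' = k₁ + 3 ∨ k₂ = k₁ + 3 ∧ k₂' = k₁ + 1)) →
    ∀ r₁ ∈ routes k₁ k₁', ∀ r₂ ∈ routes k₂ k₂', avoidB r₁ r₂ = false := by
  decide +kernel

/-! ## The generating polynomials -/

/-- Sum of `Ladj` monomials is `T_adj`. -/
theorem sum_Ladj (α β s : ℝ) : (Ladj.map (mono α β s)).sum = Tadj α β s := by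
  simp only [Ladj, List.map_cons, List.map_nil, List.sum_cons, List.sum_nil, mono, Tadj]
  ring

/-- Sum of `Lopp` monomials is `T_opp`. -/
theorem sum_Lopp (α β s : ℝ) : (Lopp.map (mono α β s)).sum = Topp α β s := by
  simp only [Lopp, List.map_cons, List.map_nil, List.sum_cons, List.sum_nil, mono, Topp]
  ring

/-- Sum of `LD` monomials is `D`. -/
theorem sum_LD (α β s : ℝ) : (LD.map (mono α β s)).sum = Dpair α β s := by
  simp only [LD, List.map_cons, List.map_nil, List.sum_cons, List.sum_nil, mono, Dpair]
  ring

/-- **Adjacent terminals**: the routes `Q_k → Q_{k±1}` have total weight `T_adj(α, β, s)`. -/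
theorem sum_routeW_adj (α β s : ℝ) {k k' : Fin 4} (h : k' = k + 1 ∨ k = k' + 1) :
    ((routes k k').map (routeW α β s)).sum = Tadj α β s := by
  have e : (routes k k').map (routeW α β s) = ((routes k k').map ecount).map (mono α β s) := by
    rw [List.map_map]
    exact List.map_congr_left fun r _ => routeW_eq_mono α β s r
  rw [e, ((perm_Ladj k k' h).map _).sum_eq, sum_Ladj]

/-- **Opposite terminals**: the routes `Q_k → Q_{k+2}` have total weight `T_opp(α, β, s)`. -/
theorem sum_routeW_opp (α β s : ℝ) {k k' : Fin 4} (h : k' = k + 2) :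
    ((routes k k').map (routeW α β s)).sum = Topp α β s := by
  have e : (routes k k').map (routeW α β s) = ((routes k k').map ecount).map (mono α β s) := by
    rw [List.map_map]
    exact List.map_congr_left fun r _ => routeW_eq_mono α β s r
  rw [e, ((perm_Lopp k k' h).map _).sum_eq, sum_Lopp]

/-- A double sum over `dpairs`. -/
theorem sum_dpairs (g : List Node → List Node → ℝ) (k₁ k₁' k₂ k₂' : Fin 4) :
    ((routes k₁ k₁').map fun r₁ => (((routes k₂ k₂').filter (avoidB r₁)).map (g r₁)).sum).sum =
      ((dpairs k₁ k₁' k₂ k₂').map fun p => g p.1 p.2).sum := by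
  unfold dpairs
  generalize routes k₁ k₁' = L₁
  induction L₁ with
  | nil => rfl
  | cons r L ih => simp [List.flatMap_cons, List.sum_append, ih, List.map_map, Function.comp_def]

/-- **Non-crossing pairing**: for two complementary ADJACENT terminal pairs, the ordered pairs
(route, disjoint route) have total weight `D(α, β, s)`. -/
theorem sum_pair_noncross (α β s : ℝ) {k₁ k₁' k₂ k₂' : Fin 4}
    (h : (k₁' = k₁ + 1 ∧ (k₂ = k₁ + 2 ∧ k₂' = k₁ + 3 ∨ k₂ = k₁ + 3 ∧ k₂' = k₁ + 2)) ∨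
      (k₁ = k₁' + 1 ∧ (k₂ = k₁' + 2 ∧ k₂' = k₁' + 3 ∨ k₂ = k₁' + 3 ∧ k₂' = k₁' + 2))) :
    ((routes k₁ k₁').map fun r₁ => routeW α β s r₁ *
        (((routes k₂ k₂').filter (avoidB r₁)).map (routeW α β s)).sum).sum = Dpair α β s := by
  have e1 : ((routes k₁ k₁').map fun r₁ => routeW α β s r₁ *
      (((routes k₂ k₂').filter (avoidB r₁)).map (routeW α β s)).sum) =
      (routes k₁ k₁').map fun r₁ => (((routes k₂ k₂').filter (avoidB r₁)).map
        fun r₂ => routeW α β s r₁ * routeW α β s r₂).sum := by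
    refine List.map_congr_left fun r₁ _ => ?_
    rw [← List.sum_map_mul_left]
  rw [e1, sum_dpairs]
  have e2 : ((dpairs k₁ k₁' k₂ k₂').map fun p => routeW α β s p.1 * routeW α β s p.2) =
      ((dpairs k₁ k₁' k₂ k₂').map fun p => ecount p.1 + ecount p.2).map (mono α β s) := by
    rw [List.map_map]
    refine List.map_congr_left fun p _ => ?_
    simp only [Function.comp_apply, routeW_eq_mono, mono_add]
  rw [e2, ((perm_LD k₁ k₁' k₂ k₂' h).map _).sum_eq, sum_LD]

/-- **Crossing pairing**: no route `Q_k → Q_{k+2}` is avoided by a route joining the two other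
terminals. -/
theorem filter_avoid_eq_nil_of_cross {k₁ k₁' k₂ k₂' : Fin 4}
    (h : k₁' = k₁ + 2 ∧ (k₂ = k₁ + 1 ∧ k₂' = k₁ + 3 ∨ k₂ = k₁ + 3 ∧ k₂' = k₁ + 1))
    {r₁ : List Node} (hr₁ : r₁ ∈ routes k₁ k₁') : (routes k₂ k₂').filter (avoidB r₁) = [] := by
  rw [List.filter_eq_nil_iff]
  intro r₂ hr₂
  simp [not_avoid_of_cross k₁ k₁' k₂ k₂' h r₁ hr₁ r₂ hr₂]

/-- **Shared terminal**: no route from/to a terminal of `r₁` avoids `r₁`. -/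
theorem filter_avoid_eq_nil_of_shared {k₁ k₁' k₂ k₂' : Fin 4}
    (h : k₂ = k₁ ∨ k₂ = k₁' ∨ k₂' = k₁ ∨ k₂' = k₁') {r₁ : List Node} (hr₁ : r₁ ∈ routes k₁ k₁') :
    (routes k₂ k₂').filter (avoidB r₁) = [] := by
  rw [List.filter_eq_nil_iff]
  intro r₂ hr₂ havoid
  rw [avoidB_iff] at havoid
  obtain ⟨h1, h1'⟩ := ends_mem_of_mem_routes hr₁
  obtain ⟨h2, h2'⟩ := ends_mem_of_mem_routes hr₂
  rcases h with rfl | rfl | rfl | rfl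
  · exact havoid _ h2 h1
  · exact havoid _ h2 h1'
  · exact havoid _ h2' h1
  · exact havoid _ h2' h1'

end Summit.CriticalPhenomena.SAWScalingLimit.Cruxes.HexTransfer.Sketch.PortDict
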